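import Literature.Algebra.EuclideanLattices.LatticeComplexity
import HarnessLib

/-!
# The quantum-hardness wall `GapSVPQuantumHardness` (pqc.S25) is a conjecture: consequences

`Literature.Algebra.EuclideanLattices.GapSVPQuantumHardness` (file `LatticeComplexity`) vendors
the standard worst-case assumption of lattice cryptography — `GapSVP_γ ∉ PromiseBQP` for every
polynomially bounded factor `γ ≥ 1` — as a named `Prop`.  The source states it as a
CONJECTURE, not a theorem: the lattice problems `SVP_γ`, `GapSVP_γ`, `SIVP_γ`, `BDD_γ` "have
been intensively studied and appear to be intractable, except for very large approximation
factors", polynomial-time algorithms reaching only `γ = 2^{Θ(n log log n / log n)}`, and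
"importantly, the above also represents the state of the art for quantum algorithms"
(Peikert 2016, §2.2.2, paragraph "Algorithms and complexity"); "there are no known quantum algorithms for
`GapSVP_γ` or `SIVP_γ` that significantly outperform classical ones, beyond generic quantum
speedups" (§4.2.2); Regev's cryptosystem rests "on the conjectured quantum hardness of
`GapSVP_γ` or `SIVP_γ` for `γ = Õ(n^{3/2})`" (§4.2.3).  Nothing in print proves it, and this
file records inside Lean why nothing here can: the conjecture separates `NP` from `BQP`.

## Content

* `promiseLift_BQP_subset_promiseBQP` : `promiseLift BQP ⊆ PromiseBQP` (a `BQP` language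
  separating YES from NO decides the promise problem); local glue on G11's `PromiseBQP`.
* `promiseNP_subset_promiseBQP_of_NP_subset_BQP` : `NP ⊆ BQP → PromiseNP ⊆ PromiseBQP`.
* `gapSVPPromise_mem_promiseLift_of_le` : enlarging the gap stays inside `promiseLift C`.
* `isPolyBoundedReal_max_one_const_mul_sqrt` : `max(1, c√n)` is polynomially bounded.
* `GapSVPQuantumHardness.not_NP_subset_BQP` : S25 together with the `PromiseNP` half of
  Aharonov–Regev (S16, named fact `gapSVP_sqrt_mem_promiseNP_inter_promiseCoNP`) gives
  `¬ NP ⊆ BQP`.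
* `GapSVPQuantumHardness.P_ne_NP` : adding the named fact `P_subset_BQP`, `P ≠ NP`.

So a discharge `theorem GapSVPQuantumHardness_holds` would, modulo two textbook facts, settle
`P` versus `NP`; pqc.S25 therefore stays a hypothesis `(h : GapSVPQuantumHardness)` (D-0014:
open conjectures are `def … : Prop`, never theorems).

## Sources

* C. Peikert, *A decade of lattice cryptography*, Found. Trends Theor. Comput. Sci. 10(4)
  (2016) 283–424; section numbers as in the full version (= IACR ePrint 2015/939): §2.2.2
  ("Computational problems": Defs. 2.2.1–2.2.5 and the paragraph "Algorithms and
  complexity"), §4.2.2 (after Thm. 4.2.4), §4.2.3 (first paragraph).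
* O. Regev, *On lattices, learning with errors, random linear codes, and cryptography*,
  J. ACM 56 (2009), §1 (the conjecture that no polynomial-time quantum algorithm approximates
  `GapSVP`/`SIVP` to within polynomial factors).
* D. Aharonov, O. Regev, *Lattice problems in NP ∩ coNP*, J. ACM 52 (2005), Thm. 1.1.
* J. Watrous, *Quantum computational complexity* (2009), §III.2 (`PromiseBQP`).

## Not here

No new definitions and no new facts: every statement below is proved from the tree.  The
conjecture itself is not restated (import `LatticeComplexity`).
-/

noncomputable section

open Computability Literature.Computability.Complexity
  Literature.Computability.Complexity.Nondeterministic Literature.Computability.Cryptography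

namespace Literature.Algebra.EuclideanLattices

/-- A promise problem separated by a `BQP` language is in `PromiseBQP`: the uniform family
deciding `L` with error `≤ 1/3` on every input accepts every yes-instance (`⊆ L`) with
probability `≥ 2/3` and every no-instance (`⊆ Lᶜ`) with probability `≤ 1/3`; i.e.
`promiseLift BQP ⊆ PromiseBQP` (the converse fails in general: `PromiseBQP` asks nothing off
the promise).  LOCAL GLUE on G11's `PromiseBQP`; candidate for upstreaming next to
`Literature.Computability.Cryptography.ofLanguage_mem_PromiseBQP_iff`.
[Watrous 2009, §III.2; Goldreich 2006, §1.1–1.2] [cite: Watrous2009, §III.2] -/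
theorem promiseLift_BQP_subset_promiseBQP : promiseLift BQP ⊆ PromiseBQP := by
  rintro Q ⟨L, hL, hy, hn⟩
  obtain ⟨F, hF, hU, h⟩ := ClassBQP.mem_BQP_iff.1 hL
  exact ⟨F, hF, hU, fun x hx => (h x).1 (hy hx), fun x hx => (h x).2 (hn hx)⟩

/-- If `NP ⊆ BQP` then `PromiseNP ⊆ PromiseBQP` (lift the inclusion, then
`promiseLift_BQP_subset_promiseBQP`). [Watrous 2009, §III.2; Goldreich 2006, §1.2]
[cite: Watrous2009, §III.2] -/
theorem promiseNP_subset_promiseBQP_of_NP_subset_BQP (hNB : NP ⊆ BQP) :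
    PromiseNP ⊆ PromiseBQP :=
  (promiseLift_mono hNB).trans promiseLift_BQP_subset_promiseBQP

/-- Enlarging the gap keeps `GapSVP` inside any promise-lifted class: for `γ ≤ γ'` pointwise,
`GapSVP_γ ∈ promiseLift C → GapSVP_{γ'} ∈ promiseLift C` (same YES set, fewer NO instances by
`GapSVP.no_subset_no_of_le`, so the same separating language works).
[Micciancio–Goldwasser 2002, Ch. 1, §1.2] [cite: MicciancioGoldwasser2002, Ch. 1  §1.2] -/
theorem gapSVPPromise_mem_promiseLift_of_le {C : Set (Language Bool)} {γ γ' : ℕ → ℝ}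
    (h : γ ≤ γ') (hγ : gapSVPPromise γ ∈ promiseLift C) : gapSVPPromise γ' ∈ promiseLift C := by
  obtain ⟨L, hL, hy, hn⟩ := hγ
  refine ⟨L, hL, hy, fun x hx => hn ?_⟩
  obtain ⟨p, hp, rfl⟩ := hx
  exact ⟨p, GapSVP.no_subset_no_of_le h hp, rfl⟩

/-- The factor `max(1, c√n)` is polynomially bounded: by `p + 1` whenever `c√n ≤ p(n)`
(`isPolyBoundedReal_const_mul_sqrt`). [Arora–Barak 2009, §1.6] [cite: AroraBarak2009, §1.6] -/
theorem isPolyBoundedReal_max_one_const_mul_sqrt (c : ℝ) :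
    IsPolyBoundedReal fun n => max 1 (c * Real.sqrt n) := by
  obtain ⟨p, hp⟩ := isPolyBoundedReal_const_mul_sqrt c
  refine ⟨p + 1, fun n => ?_⟩
  simp only [Polynomial.eval_add, Polynomial.eval_one, Nat.cast_add, Nat.cast_one]
  exact max_le (le_add_of_nonneg_left (Nat.cast_nonneg _))
    ((hp n).trans (le_add_of_nonneg_right zero_le_one))

/-- **`GapSVPQuantumHardness` separates `NP` from `BQP`** (given the `PromiseNP` half of
Aharonov–Regev, S16).  If `NP ⊆ BQP`, the `NP` language separating `GapSVP_{c√n}` is decided by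
a poly-time uniform quantum family, which then decides the promise problem
`GapSVP_{max(1, c√n)}` — a polynomially bounded factor `≥ 1` — contradicting S25.  Hence a
proof of `GapSVPQuantumHardness` would in particular prove the open separation `NP ⊄ BQP`; this
is why pqc.S25 is a named conjecture (`def … : Prop`) and is never discharged.  The conjecture
is Regev, J. ACM 56 (2009), §1 and Peikert 2016, §2.2.2 ("Algorithms and complexity") and
§4.2.2–4.2.3; the implication itself is a standard one-line remark. [folklore] -/
theorem GapSVPQuantumHardness.not_NP_subset_BQP (h : GapSVPQuantumHardness)
    (h16 : gapSVP_sqrt_mem_promiseNP_inter_promiseCoNP) : ¬ NP ⊆ BQP := by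
  intro hNB
  obtain ⟨c, -, hNP, -⟩ := h16
  refine h (fun n => max 1 (c * Real.sqrt n)) (isPolyBoundedReal_max_one_const_mul_sqrt c)
    (fun n => le_max_left _ _) ?_
  exact promiseNP_subset_promiseBQP_of_NP_subset_BQP hNB
    (gapSVPPromise_mem_promiseLift_of_le (fun n => le_max_right _ _) hNP)

/-- **`GapSVPQuantumHardness` implies `P ≠ NP`** (given S16 and the named fact `P ⊆ BQP`,
`Literature.Computability.Cryptography.P_subset_BQP`): if `P = NP` then `NP = P ⊆ BQP`,
contradicting `GapSVPQuantumHardness.not_NP_subset_BQP`.  Recorded only to certify that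
discharging pqc.S25 is out of reach (it would settle `P` versus `NP`); nothing here bears on
the truth of either statement.  (`P ⊆ BQP`: Bernstein–Vazirani 1997, §8; the conjecture:
Regev 2009, §1, Peikert 2016, §2.2.2 and §4.2.2.) [folklore] -/
theorem GapSVPQuantumHardness.P_ne_NP (h : GapSVPQuantumHardness)
    (h16 : gapSVP_sqrt_mem_promiseNP_inter_promiseCoNP) (hPB : P_subset_BQP) :
    Classes.P ≠ NP :=
  fun hPNP => h.not_NP_subset_BQP h16 (hPNP ▸ hPB)

end Literature.Algebra.EuclideanLattices
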